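import Summits.NavierStokesRegularity.NavierStokesRegularity.Theses.TypeIIInviscidRelaxation
import Summits.NavierStokesRegularity.NavierStokesRegularity.Theorems.TypeIIInviscidRelaxationAxisymSwirlRegularSplitTightness
import Summits.NavierStokesRegularity.NavierStokesRegularity.Theorems.TypeIIInviscidRelaxationAxisymSwirlRegularOffAxisBound
import Summits.NavierStokesRegularity.NavierStokesRegularity.Theorems.TypeIIInviscidRelaxationAxisymSwirlRegularInflowMinPrinciple
import HarnessLib

/-!
# Crux `AxisymSwirlRegular` (stmt-NavierStokesRegularity-1964), line `radial_inflow_split`: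
# the piece X₂ `AprioriRadialInflowBound` (⟨19060⟩) follows from S1 of its birth skeleton ALONE

`--supports stmt-NavierStokesRegularity-1964` (helper file; theorems only, no definitions).

The birth skeleton `Cruxes/AxisymSwirlRegular/Lines/AprioriRadialInflowBound_birth.lean` composes
`AprioriRadialInflowBound_of : X₂` from three stubs S1 (cyclostrophic defect floor, OPEN), S2
(radial-momentum minimum principle) and S3 (off-axis bound). S2 and S3 are now theorems of the tree
(`radialMomentumMinPrinciple`, `offAxisBound`), so the route item `AprioriRadialInflowBound` — BY NAME —
follows from S1 alone: `aprioriRadialInflowBound_of_cyclostrophicDefectFloor`. This module is the only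
one of the three importing the Theses file (import-cone hygiene). Nothing here closes ⟨19060⟩ or
⟨1964⟩: the hypothesis S1 (an a-priori ONE-SIDED PRESSURE statement: the inward radial pressure pull
`r∂ᵣp` exceeds the centrifugal term `u_θ² + u_r²` near the axis by at most an `L¹`-in-time amount) is
open, and it is where Hou's pressure-driven inflow scenario is confronted.
-/

noncomputable section

open Literature.Analysis.FluidPDE Set

namespace Summit.NavierStokesRegularity.NavierStokesRegularity.Theorems

-- the problem directory repeats the summit name (`NavierStokesRegularity/NavierStokesRegularity`)
set_option linter.dupNamespace false

open Summit.NavierStokesRegularity.NavierStokesRegularity.Theses.TypeIIInviscidRelaxation in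
/-- **X₂ ⟸ S1, BY NAME.** The route item `AprioriRadialInflowBound` (⟨19060⟩, piece X₂ of the line
`radial_inflow_split` of the crux `AxisymSwirlRegular` ⟨1964⟩) follows from S1 of its birth skeleton
ALONE — an `L¹`-in-time floor for the cyclostrophic defect `u_r² + u_θ² − r∂ᵣp` near the axis, in
the standing class: S2 is `radialMomentumMinPrinciple` and S3 is `offAxisBound`, both theorems. So the
open content of X₂ is exactly the one-sided PRESSURE statement S1 (in Hou's scenario the inflow jet is
pressure driven). Nothing here closes ⟨19060⟩: the hypothesis is open. [new] -/
theorem aprioriRadialInflowBound_of_cyclostrophicDefectFloor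
    (hS1 : ∀ (ν T : ℝ), 0 < ν → 0 < T → ∀ (u : ℝ → EuclideanSpace ℝ (Fin 3) → EuclideanSpace ℝ (Fin 3)) (p : ℝ → EuclideanSpace ℝ (Fin 3) → ℝ), Literature.Analysis.FluidPDE.IsClassicalNSSolutionOn (Set.Ico 0 T) ν 0 u p → Literature.Analysis.FluidPDE.IsLerayHopfOn T ν 0 (u 0) u → (∀ T' < T, ∃ M : ℝ, ∀ t ∈ Set.Icc 0 T', ∀ x, ‖u t x‖ ≤ M) → (∀ t ∈ Set.Ico 0 T, Literature.Analysis.FluidPDE.IsAxisymmetric (u t)) → Literature.Analysis.FluidPDE.HasRapidSpatialDecay (u 0) → ∃ (δ : ℝ) (g : ℝ → ℝ), 0 < δ ∧ MeasureTheory.IntegrableOn g (Set.Ico 0 T) ∧ ∀ t ∈ Set.Ico 0 T, ∀ x, Literature.Analysis.FluidPDE.cylRadius x < δ → -g t ≤ (u t x 0) ^ 2 + (u t x 1) ^ 2 - (x 0 * fderiv ℝ (p t) x (EuclideanSpace.single (0 : Fin 3) (1 : ℝ)) + x 1 * fderiv ℝ (p t) x (EuclideanSpace.single (1 : Fin 3)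 (1 : ℝ)))) :
    AprioriRadialInflowBound :=
  fun ν T hν hT u p hcl hLH hbd hax hdec =>
    radialMomentumMinPrinciple ν T hν hT u p hcl hLH hbd hax hdec
      (hS1 ν T hν hT u p hcl hLH hbd hax hdec) (offAxisBound ν T hν hT u p hcl hLH hbd hax hdec)

open Summit.NavierStokesRegularity.NavierStokesRegularity.Theses.TypeIIInviscidRelaxation in
/-- **The line's current shape, BY NAME: `AxisymSwirlRegular ⟸ OneSidedRadialCriterion ∧ S1`.** The
crux ⟨1964⟩ follows from the one-sided radial inflow criterion ⟨19059⟩ (X₁; open for `C ≥ 2`, cf.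
`ScenarioCensus.LogGate.oneSidedRadialCriterion_iff_geTwo`) and the cyclostrophic-defect floor S1 (open),
through the registered composition (`axisymSwirlRegular_iff_oneSidedRadialCriterion_and_aprioriRadialInflowBound`)
with X₂ supplied by `aprioriRadialInflowBound_of_cyclostrophicDefectFloor`. Both hypotheses are open;
nothing is closed. [new] -/
theorem axisymSwirlRegular_of_oneSidedRadialCriterion_of_cyclostrophicDefectFloor
    (hX1 : OneSidedRadialCriterion)
    (hS1 : ∀ (ν T : ℝ), 0 < ν → 0 < T → ∀ (u : ℝ → EuclideanSpace ℝ (Fin 3) → EuclideanSpace ℝ (Fin 3)) (p : ℝ → EuclideanSpace ℝ (Fin 3) → ℝ), Literature.Analysis.FluidPDE.IsClassicalNSSolutionOn (Set.Ico 0 T) ν 0 u p → Literature.Analysis.FluidPDE.IsLerayHopfOn T ν 0 (u 0) u → (∀ T' < T, ∃ M : ℝ, ∀ t ∈ Set.Icc 0 T', ∀ x, ‖u t x‖ ≤ M) → (∀ t ∈ Set.Ico 0 T, Literature.Analysis.FluidPDE.IsAxisymmetric (u t)) → Literature.Analysis.FluidPDE.HasRapidSpatialDecay (u 0) → ∃ (δ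 : ℝ) (g : ℝ → ℝ), 0 < δ ∧ MeasureTheory.IntegrableOn g (Set.Ico 0 T) ∧ ∀ t ∈ Set.Ico 0 T, ∀ x, Literature.Analysis.FluidPDE.cylRadius x < δ → -g t ≤ (u t x 0) ^ 2 + (u t x 1) ^ 2 - (x 0 * fderiv ℝ (p t) x (EuclideanSpace.single (0 : Fin 3) (1 : ℝ)) + x 1 * fderiv ℝ (p t) x (EuclideanSpace.single (1 : Fin 3) (1 : ℝ)))) :
    AxisymSwirlRegular :=
  axisymSwirlRegular_iff_oneSidedRadialCriterion_and_aprioriRadialInflowBound.2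
    ⟨hX1, aprioriRadialInflowBound_of_cyclostrophicDefectFloor hS1⟩

end Summit.NavierStokesRegularity.NavierStokesRegularity.Theorems

end
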